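import Summits.CriticalPhenomena.PercolationContinuityZ3.Theorems.PercNearOneGluingNoHeavyLowerTailKNGoodPocketBHKBase
import HarnessLib

/-!
# `NoHeavyLowerTail` (stmt-CriticalPhenomena-4575) — the POCKET-AUGMENTED van den Berg–Häggström–Kahn
# inequality, II: conditioning on the neighbours of `Z` (BHK's identity (6) for the pocket-augmented event)

Support file (`--supports stmt-CriticalPhenomena-4575`, hull-port prover `prim-hp-2`, gen 21).  No named facts, no
sorries; standard axioms.  Second file of the series (see `…KNGoodPocketBHKBase.lean`).

BHK's induction (Thm. 1.1, pp. 4–5) conditions on the random set `S` of vertices outside `Z = X ∩ Y` joined to `Z`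
by an open edge; given `S`, the events `A R_W` (`W ⊇ Z`) become events of the same kind for percolation on `G ∖ Z`
(their identity (6); tree `BHK2006.mem_rD_iff_restrict`, `BHK2006.step_sum`).  The point of this file is that the
pocket-augmented event `F = {o ↔ s} ∪ {C(o) ∈ 𝒬}` (members of `𝒬` disjoint from `Z`) ALSO stays in its class:

* `KNGoodPocketBHK.oV_eq_iff_restrict` — for `W ∩ Z = ∅`: `C^U(o) = W ⟺ C^{U∖Z}(o) = W ∧ W ∩ S = ∅`;
* `KNGoodPocketBHK.mem_fEv_iff_restrict` — on `{s ↮ S in G[U∖Z]}`: `F^U_𝒬 = F^{U∖Z}_{𝒬 ∩ {W : W ∩ S = ∅}}`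
  (the family SHRINKS as `S` grows — the monotonicity the four functions theorem needs);
* `KNGoodPocketBHK.blockF`, `blockF_antitone`, and `KNGoodPocketBHK.step_sumF` — BHK's (6) summed:
  `E[H(C_s^U) 1_F 1{s↮W}] = Σ_ω weight(ω) · E'[H(C_s^{U∖Z}) 1_{F'_{S(ω)}} 1{s ↮ (W∖Z) ∪ S(ω)}]`.
[cite: VandenbergHaggstromKahn2005, Thm. 1.1 (pp. 3–5), identity (6) (p. 4)] [cite: KozmaNitzan2024, §3.2 (p. 12)]
-/

noncomputable section

namespace Summit.CriticalPhenomena.PercolationContinuityZ3.Theorems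

open MeasureTheory Set Literature.Probability.LatticeModels Literature.Probability.Percolation
open Literature.Probability.Percolation.BHK2006
open DecisionTree (ind ind_of_mem ind_of_not_mem ind_nonneg)
open scoped Classical

namespace KNGoodPocketBHK

variable {V : Type*}

/-! ### Conditioning on `S`: the pocket-augmented event restricted to `U ∖ Z` -/

section Restrict

/-- If every vertex reachable from `o` in `G[U]` lies outside `Z`, then it is reachable in `G[U ∖ Z]`. [folklore] -/
theorem reach_sdiff_of_forall {U Z : Finset V} {o : V} {ω : Set (Sym2 V)}
    (h : ∀ u, (openGraph (ω ∩ edgesIn U)).Reachable o u → u ∉ Z) {v : V}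
    (hv : (openGraph (ω ∩ edgesIn U)).Reachable o v) : (openGraph (ω ∩ edgesIn (U \ Z))).Reachable o v := by
  rw [SimpleGraph.reachable_iff_reflTransGen] at hv
  induction hv with
  | refl => exact SimpleGraph.Reachable.refl o
  | tail hab hbc ih =>
    obtain ⟨hω, ⟨hbU, hcU⟩, hne⟩ := adj_iff.1 hbc
    have hab' : (openGraph (ω ∩ edgesIn U)).Reachable o _ := (SimpleGraph.reachable_iff_reflTransGen _ _).2 hab
    have hb := h _ hab'
    have hc := h _ (hab'.trans hbc.reachable)
    exact ih.trans (SimpleGraph.Adj.reachable (adj_iff.2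
      ⟨hω, ⟨Finset.mem_sdiff.2 ⟨hbU, hb⟩, Finset.mem_sdiff.2 ⟨hcU, hc⟩⟩, hne⟩))

/-- **Pockets and the conditioning on `S`**: for a pocket `W` disjoint from `Z`,
`C^U(o) = W` iff `C^{U∖Z}(o) = W` and no vertex of `W` has an open edge to `Z`.
[cite: VandenbergHaggstromKahn2005, §1 p. 4, identity (6)] -/
theorem oV_eq_iff_restrict {U Z : Finset V} (hZU : Z ⊆ U) {o : V} {W : Set V} (hWZ : Disjoint W ↑Z)
    (ω : Set (Sym2 V)) : oV U o ω = W ↔ oV (U \ Z) o ω = W ∧ Disjoint W (rS U Z ω) := by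
  constructor
  · intro h
    -- no vertex reachable from `o` in `G[U]` lies in `Z`
    have hZ : ∀ u, (openGraph (ω ∩ edgesIn U)).Reachable o u → u ∉ Z := by
      intro u hu huZ
      have huW : u ∈ W := by rw [← h]; exact hu
      exact Set.disjoint_left.1 hWZ huW (Finset.mem_coe.2 huZ)
    refine ⟨?_, ?_⟩
    · ext v
      constructor
      · intro hv
        rw [← h]
        exact oV_mono_U Finset.sdiff_subset o ω hv
      · intro hv
        rw [← h] at hv
        exact reach_sdiff_of_forall hZ hv
    · rw [Set.disjoint_left]
      rintro n hnW ⟨hnUZ, z, hzZ, hnz⟩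
      have hn : (openGraph (ω ∩ edgesIn U)).Reachable o n := by rw [← h] at hnW; exact hnW
      have hne : n ≠ z := fun e => (Finset.mem_sdiff.1 hnUZ).2 (e ▸ hzZ)
      have hz : (openGraph (ω ∩ edgesIn U)).Reachable o z :=
        hn.trans (SimpleGraph.Adj.reachable (adj_iff.2 ⟨hnz, ⟨(Finset.mem_sdiff.1 hnUZ).1, hZU hzZ⟩, hne⟩))
      exact hZ z hz hzZ
  · rintro ⟨h, hS⟩
    have hZ' : ∀ u, (openGraph (ω ∩ edgesIn U)).Reachable o u → (openGraph (ω ∩ edgesIn (U \ Z))).Reachable o u := by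
      intro u hu
      rw [SimpleGraph.reachable_iff_reflTransGen] at hu
      induction hu with
      | refl => exact SimpleGraph.Reachable.refl o
      | @tail b c _ hbc ih =>
        obtain ⟨hω, ⟨hbU, hcU⟩, hne⟩ := adj_iff.1 hbc
        have hbW : b ∈ W := by rw [← h]; exact ih
        have hbZ : b ∉ Z := fun hbZ => Set.disjoint_left.1 hWZ hbW (Finset.mem_coe.2 hbZ)
        have hcZ : c ∉ Z := fun hcZ =>
          Set.disjoint_left.1 hS hbW ⟨Finset.mem_sdiff.2 ⟨hbU, hbZ⟩, c, hcZ, hω⟩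
        exact ih.trans (SimpleGraph.Adj.reachable (adj_iff.2
          ⟨hω, ⟨Finset.mem_sdiff.2 ⟨hbU, hbZ⟩, Finset.mem_sdiff.2 ⟨hcU, hcZ⟩⟩, hne⟩))
    ext v
    constructor
    · intro hv
      rw [← h]
      exact hZ' v hv
    · intro hv
      rw [← h] at hv
      exact oV_mono_U Finset.sdiff_subset o ω hv

/-- **BHK's identity (6) for the pocket-augmented event**: on `{s ↮ S in G[U∖Z]}` (the restricted form of
`{s ↮ Z}`), `F^U_𝒬 = F^{U∖Z}_{𝒬 ∩ {W : W ∩ S = ∅}}` (all members of `𝒬` disjoint from `Z`).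
[cite: VandenbergHaggstromKahn2005, §1 p. 4, identity (6)] -/
theorem mem_fEv_iff_restrict {U Z : Finset V} (hZU : Z ⊆ U) {s o : V} (hs : s ∉ Z) {Q : Set (Set V)}
    (hQ : ∀ W ∈ Q, Disjoint W ↑Z) {ω : Set (Sym2 V)}
    (hR : ∀ n ∈ rS U Z ω, ¬ (openGraph (ω ∩ edgesIn (U \ Z))).Reachable s n) :
    ω ∈ fEv U s o Q ↔ ω ∈ fEv (U \ Z) s o (qRestr Q (rS U Z ω)) := by
  have e1 : s ∈ oV U o ω ↔ s ∈ oV (U \ Z) o ω := by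
    refine ⟨fun h => ?_, fun h => oV_mono_U Finset.sdiff_subset o ω h⟩
    have h' : (openGraph (ω ∩ edgesIn U)).Reachable s o := SimpleGraph.Reachable.symm h
    exact SimpleGraph.Reachable.symm (reach_restrict hs hR h').2
  have e2 : oV U o ω ∈ Q ↔ oV (U \ Z) o ω ∈ qRestr Q (rS U Z ω) := by
    constructor
    · intro h
      obtain ⟨h1, h2⟩ := (oV_eq_iff_restrict hZU (hQ _ h) ω).1 rfl
      exact ⟨h1.symm ▸ h, h1.symm ▸ h2⟩
    · rintro ⟨h1, h2⟩
      rw [(oV_eq_iff_restrict hZU (hQ _ h1) ω).2 ⟨rfl, h2⟩]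
      exact h1
  simp only [fEv, Set.mem_setOf_eq, e1, e2]

/-- The pocket-augmented event of `G[U ∖ Z]` does not depend on the pairs meeting `Z`. [folklore] -/
theorem mem_fEv_diff_meeting (U Z : Finset V) (s o : V) (Q : Set (Set V)) (ω : Set (Sym2 V)) :
    ω \ meeting Z ∈ fEv (U \ Z) s o Q ↔ ω ∈ fEv (U \ Z) s o Q := by
  have : oV (U \ Z) o (ω \ meeting Z) = oV (U \ Z) o ω := by
    simp only [oV, diff_meeting_inter_edgesIn]
  simp only [fEv, Set.mem_setOf_eq, this]

/-- The same at the level of indicators. [folklore] -/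
theorem ind_fEv_diff_meeting (U Z : Finset V) (s o : V) (Q : Set (Set V)) (ω : Set (Sym2 V)) :
    ind (fEv (U \ Z) s o Q) (ω \ meeting Z) = ind (fEv (U \ Z) s o Q) ω := by
  by_cases h : ω ∈ fEv (U \ Z) s o Q
  · rw [ind_of_mem h, ind_of_mem ((mem_fEv_diff_meeting U Z s o Q ω).2 h)]
  · rw [ind_of_not_mem h, ind_of_not_mem fun h' => h ((mem_fEv_diff_meeting U Z s o Q ω).1 h')]

variable [Fintype V]

/-- The block expectation `T ↦ E[H(C_s^{U'}) · 1_{F^{U'}_{𝒬 ∩ {W : W ∩ T = ∅}}} · 1{s ↮ B ∪ T in G[U']}]`.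
[cite: VandenbergHaggstromKahn2005, §1 p. 4 (`Pr(· | S)`)] -/
def blockF (w : Sym2 V → ℝ) (U' : Finset V) (s o : V) (H : Set (Sym2 V) → ℝ) (Q : Set (Set V)) (B T : Set V) : ℝ :=
  ∑ ω, weight w ω * (H (rC U' s ω) * ind (fEv U' s o (qRestr Q T)) ω * ind (rD U' s (B ∪ T)) ω)

/-- Block expectations of nonnegative functions are nonnegative. [folklore] -/
theorem blockF_nonneg {w : Sym2 V → ℝ} (hw0 : ∀ e, 0 ≤ w e) (hw1 : ∀ e, w e ≤ 1) (U' : Finset V) (s o : V)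
    {H : Set (Sym2 V) → ℝ} (hH : ∀ a, 0 ≤ H a) (Q : Set (Set V)) (B T : Set V) : 0 ≤ blockF w U' s o H Q B T :=
  Finset.sum_nonneg fun ω _ => mul_nonneg (weight_nonneg hw0 hw1 ω)
    (mul_nonneg (mul_nonneg (hH _) (ind_nonneg _ _)) (ind_nonneg _ _))

/-- The block expectation is antitone in `T` (both `𝒬 ∩ {W ∩ T = ∅}` and `{s ↮ B ∪ T}` shrink) and in `B`.
[cite: VandenbergHaggstromKahn2005, §1 p. 5 (second inequality of the display)] -/
theorem blockF_antitone {w : Sym2 V → ℝ} (hw0 : ∀ e, 0 ≤ w e) (hw1 : ∀ e, w e ≤ 1) (U' : Finset V) (s o : V)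
    {H : Set (Sym2 V) → ℝ} (hH : ∀ a, 0 ≤ H a) (Q : Set (Set V)) {B B' T T' : Set V} (hB : B ⊆ B') (hT : T ⊆ T') :
    blockF w U' s o H Q B' T' ≤ blockF w U' s o H Q B T :=
  Finset.sum_le_sum fun ω _ => mul_le_mul_of_nonneg_left
    (mul_le_mul (mul_le_mul_of_nonneg_left (ind_mono (fEv_mono (qRestr_mono hT)) ω) (hH _))
      (ind_mono (rD_antitone (Set.union_subset_union hB hT)) ω) (ind_nonneg _ _)
      (mul_nonneg (hH _) (ind_nonneg _ _)))
    (weight_nonneg hw0 hw1 ω)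

/-- **BHK's (6) with the pocket-augmented event**:
`E[H(C_s^U) 1_F 1{s ↮ W in G[U]}] = Σ_ω weight(ω) · E'[H(C_s^{U∖Z}) 1_{F'_{S(ω)}} 1{s ↮ (W∖Z) ∪ S(ω)}]` for `Z ⊆ W`.
[cite: VandenbergHaggstromKahn2005, §1 p. 4, identity (6)] -/
theorem step_sumF {U Z : Finset V} (hZU : Z ⊆ U) {s o : V} (hs : s ∉ Z) {W : Set V}
    (hZW : (↑Z : Set V) ⊆ W) (w : Sym2 V → ℝ) (hm : ∑ ω, weight w ω = 1)
    (H : Set (Sym2 V) → ℝ) {Q : Set (Set V)} (hQ : ∀ W' ∈ Q, Disjoint W' ↑Z) :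
    ∑ ω, weight w ω * (H (rC U s ω) * ind (fEv U s o Q) ω * ind (rD U s W) ω) =
      ∑ ω, weight w ω * blockF w (U \ Z) s o H Q (W \ ↑Z) (rS U Z ω) := by
  set A := meeting Z with hA
  set Φ : Set (Sym2 V) → Set (Sym2 V) → ℝ := fun ζ η =>
    H (rC (U \ Z) s η) * ind (fEv (U \ Z) s o (qRestr Q (rS U Z ζ))) η *
      ind (rD (U \ Z) s ((W \ ↑Z) ∪ rS U Z ζ)) η with hΦ
  have h1 : ∀ ω, H (rC U s ω) * ind (fEv U s o Q) ω * ind (rD U s W) ω = Φ (ω ∩ A) (ω \ A) := by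
    intro ω
    simp only [hΦ, hA, rS_inter_meeting, rC_diff_meeting, ind_fEv_diff_meeting]
    by_cases hω : ω ∈ rD U s W
    · have hω' := (mem_rD_iff_restrict hZU hs hZW ω).1 hω
      have hR : ∀ n ∈ rS U Z ω, ¬ (openGraph (ω ∩ edgesIn (U \ Z))).Reachable s n := fun n hn => hω' n (Or.inr hn)
      rw [ind_of_mem hω, ind_of_mem ((mem_rD_diff_meeting U Z s _ ω).2 hω'), rC_restrict hs hR]
      by_cases hF : ω ∈ fEv U s o Q
      · rw [ind_of_mem hF, ind_of_mem ((mem_fEv_iff_restrict hZU hs hQ hR).1 hF)]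
      · rw [ind_of_not_mem hF, ind_of_not_mem fun h => hF ((mem_fEv_iff_restrict hZU hs hQ hR).2 h)]
    · have hω' : ω \ meeting Z ∉ rD (U \ Z) s ((W \ ↑Z) ∪ rS U Z ω) := fun h =>
        hω ((mem_rD_iff_restrict hZU hs hZW ω).2 ((mem_rD_diff_meeting U Z s _ ω).1 h))
      rw [ind_of_not_mem hω, ind_of_not_mem hω', mul_zero, mul_zero]
  have h2 : ∀ ω ω', Φ (ω ∩ A) (ω' \ A) = H (rC (U \ Z) s ω') * ind (fEv (U \ Z) s o (qRestr Q (rS U Z ω))) ω' *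
      ind (rD (U \ Z) s ((W \ ↑Z) ∪ rS U Z ω)) ω' := by
    intro ω ω'
    simp only [hΦ, hA, rS_inter_meeting, rC_diff_meeting, ind_fEv_diff_meeting]
    by_cases hω' : ω' ∈ rD (U \ Z) s ((W \ ↑Z) ∪ rS U Z ω)
    · rw [ind_of_mem hω', ind_of_mem ((mem_rD_diff_meeting U Z s _ ω').2 hω')]
    · rw [ind_of_not_mem hω', ind_of_not_mem (fun h => hω' ((mem_rD_diff_meeting U Z s _ ω').1 h))]
  calc ∑ ω, weight w ω * (H (rC U s ω) * ind (fEv U s o Q) ω * ind (rD U s W) ω)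
      = (∑ ω, weight w ω) * ∑ ω, weight w ω * Φ (ω ∩ A) (ω \ A) := by
        rw [hm, one_mul]; simp_rw [h1]
    _ = ∑ ω, weight w ω * ∑ ω', weight w ω' * Φ (ω ∩ A) (ω' \ A) := blockFubini w A Φ
    _ = ∑ ω, weight w ω * blockF w (U \ Z) s o H Q (W \ ↑Z) (rS U Z ω) := by
        simp_rw [h2]; rfl

end Restrict

end KNGoodPocketBHK

end Summit.CriticalPhenomena.PercolationContinuityZ3.Theorems
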